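import Summits.BirchSwinnertonDyer.Rank1Residual.Additive.LocalSubgroupTransport
import Summits.BirchSwinnertonDyer.Rank1Residual.Additive.BaseChangeSubgroupH1
import HarnessLib

/-!
# Base change of local Selmer conditions along `subgroupH1Iso`, file 1: the LOCAL PACKAGE
# (inverse transport, bijectivity of the point transport, injectivity of the local `H¹`-transport,
# and the classical local condition as an IFF)
(cell `bsd-potss`, seat `bsd-potss-k8q-c3` g2; rung K8, route `QuadraticBranchSignedControl`, crux
`EtaTransportSigned` (stmt-BirchSwinnertonDyer-19115), child `EtaLayerComparison`
(stmt-BirchSwinnertonDyer-19583) = ctrl's (i-c) at the finite layers)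

WHAT. The open mathematics of the crux is the comparison, layer by layer, of Kobayashi's Selmer
conditions for `V_F` over `F_n` (Γ_F-internal) with cc-typer-6's tower conditions for `V` over `Fℚ_n`
(Γ_ℚ-internal) under ctrl's `subgroupH1Iso`. Its local heart is a TRANSPORT along an isomorphism of
algebraic closures `ι₂ : Ē ≃ Ē'` of a `K`-completion `E` and an `L`-completion `E'` compatible with
`K`- and `L`-embeddings `ι : K̄ → Ē`, `ι' : L̄ → Ē'` (`ι' ∘ ι_L = ι₂ ∘ ι`) — the T-res package of
`Additive/LocalSubgroupTransport.lean` (n1011-p17: `transportHom θ = ι₂(·)ι₂⁻¹`,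
`transportPoints ψ = (ι₂⁻¹)_*`, and the ONE-WAY transfer `localResOverOfEmb_resH1Hom_eq_zero`). This
file makes the package TWO-WAY, for any `K ⊆ L`, `W/K`, `H ≤ galRange L`:
* §1 the inverse transport `t ↦ ι₂⁻¹ t ι₂ : Γ_{E'} → Γ_E` (the tree's `transportAut ι₂.symm`) — needs
  NO fixing hypothesis when `ι₂|_E` lands in `E'` (`hf`); `θ ∘ θ⁻¹ = id`, `θ⁻¹ ∘ θ = id`,
  `res_ι ∘ θ⁻¹ = resGal L ∘ res_{ι'}`;
* §2 the inverse point transport `ψ⁻¹ = pointsCongr ∘ (ι₂)_*`: `ψ ∘ ψ⁻¹ = id`, `ψ⁻¹ ∘ ψ = id`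
  (`transportPoints` is a bijection), and its `θ⁻¹`-equivariance;
* §3 `transportH1_injective`: the local `H¹`-transport `resH1Hom θ ψ` is injective (it has the left
  inverse `resH1Hom θ⁻¹ ψ⁻¹`);
* §4 **`localResOverOfEmb_subgroupH1Iso_eq_zero_iff`**: for `U ≤ galRange L`,
  `subgroupH1Iso x` dies at `ι` IFF `x` dies at `ι'` — the classical local condition is transported
  BOTH ways (the → of the tree plus § 3).

HONEST FRAMING (cell `bsd-potss`, run/shared/lean/pub/bsd-potss/; FULL-BSD rank ≤ 1 programme):
INFRASTRUCTURE THEOREMS ONLY (Galois-cohomology bookkeeping, Serre *Galois Cohomology* II.§1.1) —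
no definition, no named Literature fact, no `sorry`, axioms standard; nothing about (C1_η),
Kobayashi's theorems or `BSD(W, p)` is claimed; no label or count moves. Helper toward item 19583.

References: [SerreGaloisCohomology1997] I.§2.4 (compatible pairs), II.§1.1 (embeddings of separable
closures and the attached restriction maps); [GreenbergLNM1716] §2 (local conditions at the primes
of `M` above a prime of `F`).
-/

set_option autoImplicit false
set_option linter.dupNamespace false

noncomputable section

open scoped Classical

open Literature.NumberTheory.EllipticCurves
open Summit.BirchSwinnertonDyer.Rank1Residual.Additive
open Summit.BirchSwinnertonDyer.Rank1Residual.Additive.LocalTransport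
open Summit.BirchSwinnertonDyer.Rank1Residual.Additive.BaseChange

universe u

namespace Summit.BirchSwinnertonDyer.BirchSwinnertonDyer.Theorems.EtaLayer

variable {K : Type u} [Field K] (L : Type u) [Field L] [Algebra K L]
variable {E : Type u} [Field E] [Algebra K E] {E' : Type u} [Field E'] [Algebra L E']
variable (ι : AlgebraicClosure K →ₐ[K] AlgebraicClosure E)
  (ι₂ : AlgebraicClosure E ≃+* AlgebraicClosure E')
  (ι' : AlgebraicClosure L →ₐ[L] AlgebraicClosure E')
  (hcompat : ∀ z : AlgebraicClosure K, ι' (closureEmb (K := K) L z) = ι₂ (ι z))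
  (f : E →+* E')
  (hf : ∀ y : E, ι₂ (algebraMap E (AlgebraicClosure E) y) = algebraMap E' (AlgebraicClosure E') (f y))

/-! ## §1 The inverse transport `t ↦ ι₂⁻¹ t ι₂` -/

section Inverse

include hf in
/-- Every `t ∈ Γ_{E'}` fixes `ι₂(E) = f(E) ⊆ E'` — the fixing hypothesis of `transportAut ι₂.symm`
holds for free. [cite: SerreGaloisCohomology1997, II.§1.1] -/
theorem fix_symm (t : Field.absoluteGaloisGroup E') (y : E) :
    (show AlgebraicClosure E' ≃ₐ[E'] AlgebraicClosure E' from t)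
        (ι₂.symm.symm (algebraMap E (AlgebraicClosure E) y)) =
      ι₂.symm.symm (algebraMap E (AlgebraicClosure E) y) := by
  rw [RingEquiv.symm_symm, hf]
  exact AlgEquiv.commutes _ (f y)

/-- Values of the inverse transport: `(ι₂⁻¹ t ι₂)(x) = ι₂⁻¹ (t (ι₂ x))`. [folklore] -/
theorem transportAut_symm_apply (t : Field.absoluteGaloisGroup E') (ht) (x : AlgebraicClosure E) :
    (show AlgebraicClosure E ≃ₐ[E] AlgebraicClosure E from transportAut ι₂.symm t ht) x =
      ι₂.symm ((show AlgebraicClosure E' ≃ₐ[E'] AlgebraicClosure E' from t) (ι₂ x)) := by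
  rw [transportAut_apply, RingEquiv.symm_symm]

/-- `θ (θ⁻¹ t) = t`: `ι₂ (ι₂⁻¹ t ι₂) ι₂⁻¹ = t`. [cite: SerreGaloisCohomology1997, II.§1.1] -/
theorem transportAut_transportAut_symm (t : Field.absoluteGaloisGroup E') (ht) (hh) :
    transportAut ι₂ (transportAut ι₂.symm t ht) hh = t := by
  apply AlgEquiv.ext
  intro x
  rw [transportAut_apply, transportAut_symm_apply, RingEquiv.apply_symm_apply,
    RingEquiv.apply_symm_apply]

/-- `θ⁻¹ (θ h) = h`: `ι₂⁻¹ (ι₂ h ι₂⁻¹) ι₂ = h`. [cite: SerreGaloisCohomology1997, II.§1.1] -/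
theorem transportAut_symm_transportAut (h : Field.absoluteGaloisGroup E) (hh) (ht) :
    transportAut ι₂.symm (transportAut ι₂ h hh) ht = h := by
  apply AlgEquiv.ext
  intro x
  rw [transportAut_symm_apply, transportAut_apply, RingEquiv.symm_apply_apply,
    RingEquiv.symm_apply_apply]

variable [Algebra.IsAlgebraic K L]

include hcompat in
/-- **The restrictions match for the inverse transport**: `res_ι (ι₂⁻¹ t ι₂) = resGal L (res_{ι'} t)`
(from the tree's `resGal_resGalOfEmb_transportAut` applied to `h = ι₂⁻¹ t ι₂`, `ι₂ h ι₂⁻¹ = t`).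
[cite: SerreGaloisCohomology1997, II.§1.1] -/
theorem resGalOfEmb_transportAut_symm (t : Field.absoluteGaloisGroup E') (ht) :
    resGalOfEmb ι (transportAut ι₂.symm t ht) = resGal (K := K) L (resGalOfEmb (K := L) ι' t) := by
  have hh : ∀ y : E', (show AlgebraicClosure E ≃ₐ[E] AlgebraicClosure E from
      transportAut ι₂.symm t ht) (ι₂.symm (algebraMap E' (AlgebraicClosure E') y)) =
        ι₂.symm (algebraMap E' (AlgebraicClosure E') y) := fun y => by
    rw [transportAut_symm_apply, RingEquiv.apply_symm_apply, AlgEquiv.commutes]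
  have key := resGal_resGalOfEmb_transportAut L ι ι₂ ι' hcompat (transportAut ι₂.symm t ht) hh
  rw [transportAut_transportAut_symm] at key
  exact key.symm

end Inverse


/-! ## §2 The point transport `ψ = (ι₂⁻¹)_*` is a bijection; its inverse `pointsCongr ∘ (ι₂)_*` -/

section Points

variable [Algebra K E'] [IsScalarTower K L E'] (W : WeierstrassCurve K)

/-- **`ψ ∘ ψ⁻¹ = id`**: `(ι₂⁻¹)_* (pointsCongr⁻¹ (pointsCongr ((ι₂)_* P))) = P`. [folklore] -/
theorem transportPoints_pointsCongr_map (P : localPoints W E) :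
    transportPoints L ι ι₂ ι' hcompat W
        (pointsCongr W L (AlgebraicClosure E')
          (WeierstrassCurve.Affine.Point.map
            (algEquivOfCompat L ι ι₂ ι' hcompat : AlgebraicClosure E →ₐ[K] AlgebraicClosure E')
            (show (W.baseChange (AlgebraicClosure E)).toAffine.Point from P))) = P := by
  rw [transportPoints_apply, AddEquiv.symm_apply_apply, WeierstrassCurve.Affine.Point.map_map]
  have hF : ((algEquivOfCompat L ι ι₂ ι' hcompat).symm :
        AlgebraicClosure E' →ₐ[K] AlgebraicClosure E).comp
      (algEquivOfCompat L ι ι₂ ι' hcompat : AlgebraicClosure E →ₐ[K] AlgebraicClosure E') =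
      AlgHom.id K (AlgebraicClosure E) := by
    apply AlgHom.ext
    intro x
    exact (algEquivOfCompat L ι ι₂ ι' hcompat).symm_apply_apply x
  rw [hF]
  rcases P with _ | _ <;> rfl

/-- **`ψ⁻¹ ∘ ψ = id`**: `pointsCongr ((ι₂)_* ((ι₂⁻¹)_* (pointsCongr⁻¹ Q))) = Q`. [folklore] -/
theorem pointsCongr_map_transportPoints (Q : localPoints (W.baseChange L) E') :
    pointsCongr W L (AlgebraicClosure E')
        (WeierstrassCurve.Affine.Point.map
          (algEquivOfCompat L ι ι₂ ι' hcompat : AlgebraicClosure E →ₐ[K] AlgebraicClosure E')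
          (show (W.baseChange (AlgebraicClosure E)).toAffine.Point from
            transportPoints L ι ι₂ ι' hcompat W Q)) = Q := by
  rw [transportPoints_apply, WeierstrassCurve.Affine.Point.map_map]
  have hF : (algEquivOfCompat L ι ι₂ ι' hcompat : AlgebraicClosure E →ₐ[K] AlgebraicClosure E').comp
      ((algEquivOfCompat L ι ι₂ ι' hcompat).symm :
        AlgebraicClosure E' →ₐ[K] AlgebraicClosure E) = AlgHom.id K (AlgebraicClosure E') := by
    apply AlgHom.ext
    intro x
    exact (algEquivOfCompat L ι ι₂ ι' hcompat).apply_symm_apply x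
  rw [hF]
  have hid : ∀ R : ((W.baseChange L).baseChange (AlgebraicClosure E')).toAffine.Point,
      WeierstrassCurve.Affine.Point.map (W' := W) (AlgHom.id K (AlgebraicClosure E'))
        ((pointsCongr W L (AlgebraicClosure E')).symm R) =
        (pointsCongr W L (AlgebraicClosure E')).symm R := fun R => by
    rcases (pointsCongr W L (AlgebraicClosure E')).symm R with _ | _ <;> rfl
  rw [hid]
  exact (pointsCongr W L (AlgebraicClosure E')).apply_symm_apply Q

/-- **`ψ = (ι₂⁻¹)_*` is a bijection** `E_L(Ē') ≃ E(Ē)`. [cite: SerreGaloisCohomology1997, II.§1.1] -/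
theorem transportPoints_bijective : Function.Bijective (transportPoints L ι ι₂ ι' hcompat W) := by
  refine ⟨fun Q₁ Q₂ h => ?_, fun P => ⟨_, transportPoints_pointsCongr_map L ι ι₂ ι' hcompat W P⟩⟩
  rw [← pointsCongr_map_transportPoints L ι ι₂ ι' hcompat W Q₁,
    ← pointsCongr_map_transportPoints L ι ι₂ ι' hcompat W Q₂, h]

/-- **`θ⁻¹`-equivariance of `ψ⁻¹`**: `ψ⁻¹ ((ι₂⁻¹ t ι₂) • P) = t • ψ⁻¹ P` for `t ∈ Γ_{E'}`
(coordinates: `ι₂ ∘ (ι₂⁻¹ t ι₂) = t ∘ ι₂` on `Ē`). [cite: SerreGaloisCohomology1997, I.§2.4] -/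
theorem pointsCongr_map_smul (t : Field.absoluteGaloisGroup E') (ht) (P : localPoints W E) :
    (show localPoints (W.baseChange L) E' from pointsCongr W L (AlgebraicClosure E')
        (WeierstrassCurve.Affine.Point.map
          (algEquivOfCompat L ι ι₂ ι' hcompat : AlgebraicClosure E →ₐ[K] AlgebraicClosure E')
          (show (W.baseChange (AlgebraicClosure E)).toAffine.Point from
            transportAut ι₂.symm t ht • P))) =
      t • (show localPoints (W.baseChange L) E' from pointsCongr W L (AlgebraicClosure E')
        (WeierstrassCurve.Affine.Point.map
          (algEquivOfCompat L ι ι₂ ι' hcompat : AlgebraicClosure E →ₐ[K] AlgebraicClosure E')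
          (show (W.baseChange (AlgebraicClosure E)).toAffine.Point from P))) := by
  rw [localPoints.smul_def W E, localPoints.smul_def (W.baseChange L) E',
    ← pointsCongr_map, WeierstrassCurve.Affine.Point.map_map, WeierstrassCurve.Affine.Point.map_map]
  have hF : (algEquivOfCompat L ι ι₂ ι' hcompat : AlgebraicClosure E →ₐ[K] AlgebraicClosure E').comp
      ((AlgEquiv.restrictScalars K (show AlgebraicClosure E ≃ₐ[E] AlgebraicClosure E from
          transportAut ι₂.symm t ht) : AlgebraicClosure E ≃ₐ[K] AlgebraicClosure E) :
        AlgebraicClosure E →ₐ[K] AlgebraicClosure E) =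
      (((AlgEquiv.restrictScalars L (show AlgebraicClosure E' ≃ₐ[E'] AlgebraicClosure E' from t) :
            AlgebraicClosure E' ≃ₐ[L] AlgebraicClosure E') :
          AlgebraicClosure E' →ₐ[L] AlgebraicClosure E').restrictScalars K).comp
        (algEquivOfCompat L ι ι₂ ι' hcompat : AlgebraicClosure E →ₐ[K] AlgebraicClosure E') := by
    apply AlgHom.ext
    intro x
    change ι₂ ((show AlgebraicClosure E ≃ₐ[E] AlgebraicClosure E from transportAut ι₂.symm t ht) x) =
      (show AlgebraicClosure E' ≃ₐ[E'] AlgebraicClosure E' from t) (ι₂ x)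
    rw [transportAut_symm_apply, RingEquiv.apply_symm_apply]
  exact congrArg (fun F : AlgebraicClosure E →ₐ[K] AlgebraicClosure E' =>
    pointsCongr W L (AlgebraicClosure E') (WeierstrassCurve.Affine.Point.map F
      (show (W.baseChange (AlgebraicClosure E)).toAffine.Point from P))) hF

end Points

/-! ## §3 The local `H¹`-transport `resH1Hom θ ψ` is injective -/

section H1

variable [Algebra.IsAlgebraic K L]

include hcompat hf in
/-- `ι₂⁻¹ t ι₂ ∈ H_ι` for `t ∈ H'_{ι'}` when `resGal L (H') ≤ H`. [cite: SerreGaloisCohomology1997, II.§1.1] -/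
theorem transportAut_symm_mem_localSubgroupOfEmb
    (H : Subgroup (Field.absoluteGaloisGroup K)) (H' : Subgroup (Field.absoluteGaloisGroup L))
    (hH'H : ∀ τ : Field.absoluteGaloisGroup L, τ ∈ H' → resGal (K := K) L τ ∈ H)
    (t : Field.absoluteGaloisGroup E') (ht : t ∈ localSubgroupOfEmb H' ι') :
    transportAut ι₂.symm t (fix_symm ι₂ f hf t) ∈ localSubgroupOfEmb H ι := by
  rw [mem_localSubgroupOfEmb_iff, resGalOfEmb_transportAut_symm L ι ι₂ ι' hcompat]
  exact hH'H _ ht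

variable [Algebra K E'] [IsScalarTower K L E']

include hf in
/-- **The local `H¹`-transport `T = resH1Hom θ ψ : H¹(H'_{ι'}, E_L(Ē')) → H¹(H_ι, E(Ē))` is
injective**: the inverse pair `(θ⁻¹ = ι₂⁻¹(·)ι₂, ψ⁻¹ = pointsCongr ∘ (ι₂)_*)` induces a left inverse
(functoriality `resH1Hom_comp`, `θ ∘ θ⁻¹ = id`, `ψ⁻¹ ∘ ψ = id`, `resH1Hom_id`).
[cite: SerreGaloisCohomology1997, I.§2.4] -/
theorem transportH1_injective (W : WeierstrassCurve K)
    (H : Subgroup (Field.absoluteGaloisGroup K)) (H' : Subgroup (Field.absoluteGaloisGroup L))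
    (hHH' : ∀ τ : Field.absoluteGaloisGroup L, resGal (K := K) L τ ∈ H → τ ∈ H')
    (hH'H : ∀ τ : Field.absoluteGaloisGroup L, τ ∈ H' → resGal (K := K) L τ ∈ H)
    (hfix : ∀ h : Field.absoluteGaloisGroup E, resGalOfEmb ι h ∈ H → ∀ y : E',
      (show AlgebraicClosure E ≃ₐ[E] AlgebraicClosure E from h)
        (ι₂.symm (algebraMap E' (AlgebraicClosure E') y)) =
          ι₂.symm (algebraMap E' (AlgebraicClosure E') y)) :
    Function.Injective (resH1Hom (transportHom L H H' hHH' ι ι₂ ι' hcompat hfix)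
      (transportPoints L ι ι₂ ι' hcompat W)
      (transportPoints_smul L H H' hHH' ι ι₂ ι' hcompat hfix W)) := by
  -- the inverse transport `θ⁻¹ : H'_{ι'} →ₜ* H_ι`
  have hfix' : ∀ t : Field.absoluteGaloisGroup E', resGalOfEmb (K := L) ι' t ∈ H' → ∀ y : E,
      (show AlgebraicClosure E' ≃ₐ[E'] AlgebraicClosure E' from t)
          (ι₂.symm.symm (algebraMap E (AlgebraicClosure E) y)) =
        ι₂.symm.symm (algebraMap E (AlgebraicClosure E) y) := fun t _ y => fix_symm ι₂ f hf t y
  let θ' : localSubgroupOfEmb H' ι' →ₜ* localSubgroupOfEmb H ι :=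
    { toFun := fun t => ⟨transportHom₀ H' ι' ι₂.symm hfix' t,
        transportAut_symm_mem_localSubgroupOfEmb L ι ι₂ ι' hcompat f hf H H' hH'H t t.2⟩
      map_one' := Subtype.ext (map_one _)
      map_mul' := fun a b => Subtype.ext (map_mul _ a b)
      continuous_toFun := (continuous_transportHom₀ H' ι' ι₂.symm hfix').subtype_mk _ }
  have hθ'apply : ∀ t : localSubgroupOfEmb H' ι',
      ((θ' t : localSubgroupOfEmb H ι) : Field.absoluteGaloisGroup E) =
        transportAut ι₂.symm (t : Field.absoluteGaloisGroup E') (fix_symm ι₂ f hf t) := fun _ => rfl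
  -- the inverse point transport `ψ⁻¹ = pointsCongr ∘ (ι₂)_*`
  let ψ' : localPoints W E →+ localPoints (W.baseChange L) E' :=
    (pointsCongr W L (AlgebraicClosure E')).toAddMonoidHom.comp
      (WeierstrassCurve.Affine.Point.map
        (algEquivOfCompat L ι ι₂ ι' hcompat : AlgebraicClosure E →ₐ[K] AlgebraicClosure E'))
  have hψ'apply : ∀ P : localPoints W E, ψ' P = pointsCongr W L (AlgebraicClosure E')
      (WeierstrassCurve.Affine.Point.map
        (algEquivOfCompat L ι ι₂ ι' hcompat : AlgebraicClosure E →ₐ[K] AlgebraicClosure E')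
        (show (W.baseChange (AlgebraicClosure E)).toAffine.Point from P)) := fun _ => rfl
  have hθ'ψ' : ∀ (t : localSubgroupOfEmb H' ι') (P : localPoints W E), ψ' (θ' t • P) = t • ψ' P := by
    intro t P
    rw [Subgroup.smul_def, Subgroup.smul_def, hψ'apply, hψ'apply, hθ'apply]
    exact pointsCongr_map_smul L ι ι₂ ι' hcompat W (t : Field.absoluteGaloisGroup E') _ P
  -- `T' ∘ T = id`
  have hcomp : (resH1Hom θ' ψ' hθ'ψ').comp (resH1Hom (transportHom L H H' hHH' ι ι₂ ι' hcompat hfix)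
      (transportPoints L ι ι₂ ι' hcompat W) (transportPoints_smul L H H' hHH' ι ι₂ ι' hcompat hfix W)) =
      AddMonoidHom.id _ := by
    rw [resH1Hom_comp]
    have e : resH1Hom ((transportHom L H H' hHH' ι ι₂ ι' hcompat hfix).comp θ')
        (ψ'.comp (transportPoints L ι ι₂ ι' hcompat W))
        (fun x m => by simp [transportPoints_smul L H H' hHH' ι ι₂ ι' hcompat hfix W, hθ'ψ']) =
        resH1Hom (ContinuousMonoidHom.id _) (AddMonoidHom.id _) (fun _ _ => rfl) := by
      refine resH1Hom_congr (ContinuousMonoidHom.ext fun t => Subtype.ext ?_)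
        (AddMonoidHom.ext fun Q => ?_) _ _
      · rw [ContinuousMonoidHom.comp_toFun, coe_transportHom_apply]
        exact transportAut_transportAut_symm ι₂ (t : Field.absoluteGaloisGroup E')
          (fix_symm ι₂ f hf t) (hfix _ (θ' t).2)
      · rw [AddMonoidHom.comp_apply, hψ'apply, AddMonoidHom.id_apply]
        exact pointsCongr_map_transportPoints L ι ι₂ ι' hcompat W Q
    rw [e, resH1Hom_id]
  exact Function.LeftInverse.injective (g := resH1Hom θ' ψ' hθ'ψ') fun c => DFunLike.congr_fun hcomp c

end H1

/-! ## §4 The classical local condition under `subgroupH1Iso`, as an IFF -/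

section Classical

variable [Algebra.IsAlgebraic K L] [PerfectField L] [Algebra K E'] [IsScalarTower K L E']

/-- **Key identity**: `localRes_ι ∘ subgroupH1Iso = T ∘ localRes_{ι'}` on `H¹(U^L, E_L[p^∞])`,
`T = resH1Hom θ ψ` — both composites are induced by the same compatible pair (the `key` step of the
tree's `localResOverOfEmb_resH1Hom_eq_zero`, for the section `subgroupToComap` of `resGal L`).
[cite: SerreGaloisCohomology1997, I.§2.4] -/
theorem localResOverOfEmb_comp_subgroupH1Iso (W : WeierstrassCurve K) (p : ℕ)
    {U : Subgroup (Field.absoluteGaloisGroup K)} (hU : U ≤ galRange (K := K) L)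
    (hfix : ∀ h : Field.absoluteGaloisGroup E, resGalOfEmb ι h ∈ U → ∀ y : E',
      (show AlgebraicClosure E ≃ₐ[E] AlgebraicClosure E from h)
        (ι₂.symm (algebraMap E' (AlgebraicClosure E') y)) =
          ι₂.symm (algebraMap E' (AlgebraicClosure E') y)) :
    (W.localResOverOfEmb p U ι).comp (subgroupH1Iso L W p hU).toAddMonoidHom =
      (resH1Hom (transportHom L U (comapResGal L U) (fun _ h => h) ι ι₂ ι' hcompat hfix)
        (transportPoints L ι ι₂ ι' hcompat W)
        (transportPoints_smul L U (comapResGal L U) (fun _ h => h) ι ι₂ ι' hcompat hfix W)).comp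
        ((W.baseChange L).localResOverOfEmb p (comapResGal L U) ι') := by
  have hΘ : (subgroupH1Iso L W p hU).toAddMonoidHom = resH1Hom (subgroupToComap L hU)
      (primaryBaseChangeEquiv L W p).symm.toAddMonoidHom
      (primaryBaseChangeEquiv_symm_subgroupToComap_smul L W p hU) := rfl
  rw [hΘ, WeierstrassCurve.localResOverOfEmb, WeierstrassCurve.localResOverOfEmb, resH1Hom_comp,
    resH1Hom_comp]
  refine (resH1Hom_congr
    (resGalSubgroupOfEmb_comp_transportHom L U (comapResGal L U) (fun _ h => h) ι ι₂ ι' hcompat hfix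
      (subgroupToComap L hU) (resGal_subgroupToComap L hU)) ?_ _ _).symm
  apply AddMonoidHom.ext
  intro Q
  obtain ⟨P, rfl⟩ := (primaryBaseChangeEquiv L W p).surjective Q
  simp only [AddMonoidHom.coe_comp, Function.comp_apply, AddEquiv.coe_toAddMonoidHom,
    AddEquiv.symm_apply_apply, AddSubgroup.coe_subtype]
  exact transportPoints_pointsMapOfEmb L ι ι₂ ι' hcompat W p P

include hcompat hf in
/-- **The classical local condition is transported BOTH ways**: for `U ≤ galRange L` and
`x ∈ H¹(U^L, E_L[p^∞])`, `subgroupH1Iso x` dies in `H¹(U_ι, E(Ē))` IFF `x` dies in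
`H¹((U^L)_{ι'}, E_L(Ē'))` (§3: the local transport `T` is injective).
[cite: SerreGaloisCohomology1997, I.§2.4, II.§1.1] [cite: GreenbergLNM1716, §2] -/
theorem localResOverOfEmb_subgroupH1Iso_eq_zero_iff (W : WeierstrassCurve K) (p : ℕ)
    {U : Subgroup (Field.absoluteGaloisGroup K)} (hU : U ≤ galRange (K := K) L)
    (hfix : ∀ h : Field.absoluteGaloisGroup E, resGalOfEmb ι h ∈ U → ∀ y : E',
      (show AlgebraicClosure E ≃ₐ[E] AlgebraicClosure E from h)
        (ι₂.symm (algebraMap E' (AlgebraicClosure E') y)) =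
          ι₂.symm (algebraMap E' (AlgebraicClosure E') y))
    (x : (W.baseChange L).subgroupH1 p (comapResGal L U)) :
    W.localResOverOfEmb p U ι (subgroupH1Iso L W p hU x) = 0 ↔
      (W.baseChange L).localResOverOfEmb p (comapResGal L U) ι' x = 0 := by
  have key := DFunLike.congr_fun
    (localResOverOfEmb_comp_subgroupH1Iso L ι ι₂ ι' hcompat W p hU hfix) x
  simp only [AddMonoidHom.coe_comp, Function.comp_apply, AddEquiv.coe_toAddMonoidHom] at key
  rw [key]
  constructor
  · intro h
    exact transportH1_injective L ι ι₂ ι' hcompat f hf W U (comapResGal L U) (fun _ h => h)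
      (fun _ h => h) hfix (h.trans (map_zero _).symm)
  · intro h
    rw [h, map_zero]

include hcompat hf in
/-- The same for the local KERNELS: `subgroupH1Iso x ∈ localKerOverOfEmb_W U ι ↔
x ∈ localKerOverOfEmb_{W_L} U^L ι'`. [cite: GreenbergLNM1716, §2] -/
theorem subgroupH1Iso_mem_localKerOverOfEmb_iff (W : WeierstrassCurve K) (p : ℕ)
    {U : Subgroup (Field.absoluteGaloisGroup K)} (hU : U ≤ galRange (K := K) L)
    (hfix : ∀ h : Field.absoluteGaloisGroup E, resGalOfEmb ι h ∈ U → ∀ y : E',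
      (show AlgebraicClosure E ≃ₐ[E] AlgebraicClosure E from h)
        (ι₂.symm (algebraMap E' (AlgebraicClosure E') y)) =
          ι₂.symm (algebraMap E' (AlgebraicClosure E') y))
    (x : (W.baseChange L).subgroupH1 p (comapResGal L U)) :
    subgroupH1Iso L W p hU x ∈ W.localKerOverOfEmb p U ι ↔
      x ∈ (W.baseChange L).localKerOverOfEmb p (comapResGal L U) ι' :=
  localResOverOfEmb_subgroupH1Iso_eq_zero_iff L ι ι₂ ι' hcompat f hf W p hU hfix x

end Classical

end Summit.BirchSwinnertonDyer.BirchSwinnertonDyer.Theorems.EtaLayer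

end
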